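import Literature.MathematicalPhysics.QuantumFieldTheory.Balaban1983to89.B16Prop1IVAssembly

/-!
# `Balaban1983to89.B15Prop1Minimum` — T. Bałaban, *Large field renormalization. I. The basic step of the 𝐑 operation*,
Commun. Math. Phys. **122** (1989) 175–202 [Balaban1989LargeFieldI] («[IV]»), **Proposition 1** p. 194, the clause
*«An element of the orbit is a minimum of the function»* — PROVED in the abstract real-Hilbert model of its printed proof
([Balaban1989LargeFieldII] («[LF-II]») p. 359; tree `B16Prop1IVAssembly`, r13) (SKELETON rows **B15.Prop1** (owner r12)
and B16.Prop1[IV] (owner r13); mega-formalization `lit-balaban`, reader/typer block r12 gen 23; HOME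
`run/shared/lean/pub/lit-balaban/`, rows `lit-balaban-r12/ROWS-B15.md`).

statement-level skeleton of published theorems with citation tags; proofs where landed; nothing here is a claim about
the Yang–Mills mass gap

PDFs held: `paper:balaban1989-cmp122-large-field-i` (journal page = PDF page + 174; p. 194 [PDF 20]),
`paper:balaban1989-cmp122-large-field-ii` (journal page = PDF page + 354; p. 359 [PDF 5]) — both text layers re-read by
this seat (r12 gen 23, 2026-08-22).

THE PRINT.  [IV] p. 194 [PDF 20], Proposition 1 (verbatim in `B15.Prop1Printed`): *«… there exists exactly one critical
orbit of the function (1.77). An element of the orbit is a minimum of the function, and is denoted by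
V_Λ = V_Λ(V_k↾_{Z∩Λᶜ}). It satisfies the regularity condition |V_Λ(∂p′) − 1| < B₅M⁵ε for p′ ∈ Λ. (1.78) …»*.  Its only
printed proof, [LF-II] p. 359 [PDF 5]: *«We fix such an extension, and we consider the variational problem for the
function V′↾_Λ → A(U_{k,Z}(V′V_k)), where V′ satisfies mild regularity conditions. Fixing the gauge G₀ for V′ we get a
small configuration, and we can write V′ = exp iB′. We expand the function with respect to B′, the expansion has the
same form as in the exponentials in (5.2), but without the powers of g_k, and with ζ₀ = 1. Now the condition for a
critical configuration is the equation ⟨δB′, H*_{1,k}J_{k,Z}⟩ + ⟨δB′, H*_{1,k}Δ₁H_{1,k}B′⟩ +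
⟨δB′, H*_{1,k}((δ/δA)V)(H_{1,k}B′)⟩ = 0 (1.12) … Denote by P₀ the projection onto the subspace of B′ satisfying the
gauge condition B′↾_{G₀} = 0. By the inequality (1.9) the operator P₀H*_{1,k}Δ₁H_{1,k}P₀ is positive, hence invertible on
this subspace, and the inverse is bounded by γ₀⁻¹2d(100M)⁵. … Using Proposition 4 [15] and the fixed point theorem for
contractive mappings, we can easily prove that the above equation has exactly one solution, which has a bound equal to
twice a bound of the right-hand side of the equation … This proves the existence and the uniqueness statements of
Proposition 1 [IV], and the bound (1.78) [IV]. The above equations, bounds and statements are valid for 𝔤ᶜ-valued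
fields, hence the existence of the analytic extension follows immediately, and Proposition 1 [IV] is proved.»*  The
minimum clause is not argued separately in print; its two ingredients are the printed ones — the positivity (1.9) of
the quadratic part on the gauge subspace and the smallness of (δ/δA)V («Proposition 4 [15]» = [Balaban1985Variational]
Prop. 4: V is of third order).  The [15]-side twin of this step (p. 299, (141)–(142): *«A second order differential at
A′ = 0 is given by the quadratic form above, and it is positive definite. Hence A′ = 0 is a minimum of the functional»*)
is `B11Eq142LocalMin.isMinOn_of_critical` (one-norm model on one space); it is not applicable by name here, because in
the [LF-II] model the positivity (1.9) is stated in the B′-norm of `E` while the Lipschitz letter of (δ/δA)V lives in the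
A-norm of `F` — the two are bridged below by `‖H‖ ≤ h₁` and `‖H*‖ ≤ hst` exactly as in r13's `prop1IV_model_of_pos`.

WHAT IS PROVED (theorems only; Mathlib + `B16Prop1IVAssembly`; no `sorry`, no definition, no `… : Prop` fact; the model
vocabulary is r13's: real inner-product spaces `E` (gauge-fixed fields B′ on Λ) and `F` (fields A on the fine lattice),
gauge projection `P₀`, `H = H_{1,k}`, `Hst = H*_{1,k}` with `⟨Hx, y⟩ = ⟨x, Hst y⟩`, `Δ₁ = Δ₁(ζ₀)`, `dV = (δ/δA)V`, current
`J = J_{k,Z}`, positivity constant `c` of (1.9), `‖H‖ ≤ h₁`, `‖H*‖ ≤ hst`, Lipschitz constant `ℓ` of `dV` on the ball of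
radius `ρ` of `F`).
§1 THE MINIMUM FROM CRITICALITY.  For ANY function `A : E → ℝ` whose first variation at every `B′` in every direction
`δB′` is the left side of (1.12) (`hA`; print: «the condition for a critical configuration is the equation (1.12)»):
`hasDerivAt_line` (derivative along a gauge segment at every parameter), `firstVariation_diff_eq` (the first variation
at `B + t(B′ − B)` minus the one at `B` is `t⟨Hv, Δ₁Hv⟩ + ⟨Hv, dV(H(B + tv)) − dV(HB)⟩`, `v = B′ − B`),
`firstVariation_lower_bound` (that difference is `≥ t·(c/2)·‖v‖²` on the ball, from (1.9), the Lipschitz letter and r13's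
smallness `c⁻¹·hst·ℓ·h₁ ≤ ½`), **`lt_of_critical_of_ne`** / **`le_of_critical`** / `isMinOn_gaugeBall_of_critical` /
`eq_of_le_of_critical`: a (1.12)-critical configuration `B` of the gauge subspace in a ball `‖B′‖ ≤ r` with `h₁r ≤ ρ`
is the STRICT minimiser of `A` over the gauge-fixed configurations of that ball (hence the only minimiser there).
§2 THE PRINTED EXPANSION IS SUCH A FUNCTION.  `hasDerivAt_expansion`: for `Δ₁` symmetric and `dV` the Gateaux gradient
of `V : F → ℝ`, the expansion `B′ ↦ a₀ + ⟨HB′, J⟩ + ½⟨HB′, Δ₁HB′⟩ + V(HB′)` («We expand the function with respect to B′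
…»; constant + linear (current) + quadratic + higher order, the shape of [15] (81)) has first variation exactly the left
side of (1.12) — a satisfiability witness of `hA` in the printed form.
§3 CAPSTONE BY NAME.  **`prop1IV_model_of_pos_minimum`** = r13's `B16Prop1IVAssembly.prop1IV_model_of_pos` (existence and
uniqueness of the critical `B′` in the gauge ball of radius `2‖K⁻¹P₀H*J‖ ≤ 2c⁻¹hst‖J‖`, the inverse `K⁻¹` from (1.9))
∧ the minimum clause: that `B′` minimises `A` — strictly — over the gauge-fixed configurations of the existence ball, and
of every larger ball of radius `r` with `h₁r ≤ ρ` (the whole Proposition-4 chart).  NO hypothesis is added to r13's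
besides the function `A` and its first variation `hA`.

HONEST SCOPE.  (i) Neither the Wilson action `A(U_{k,Z}(·))`, the chart `V′ = exp iB′`, nor `H_{1,k}`, `Δ₁(ζ₀)`, `V`,
`J_{k,Z}` are constructed (as in r13's files): the function is abstract data with the printed first variation, and §2
only shows that the printed expansion has it.  (ii) «Minimum» is read as: minimum over the gauge-fixed configurations
(`P₀B′ = B′`, «Fixing the gauge G₀ for V′») in a ball on which Proposition 4 [15] applies; minimality among all
configurations of (1.77) is then the gauge invariance of the action, not modelled.  (iii) The row-B15.Prop1 statement of
record `B15.Prop1Printed` (over the abstract carrier `B15.LFVar`) is NOT discharged here — no `LFVar` instance is built;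
what this file adds is a kernel theorem for the one clause of Proposition 1 that had none (r13's four `B16Prop1IV*` files
cover existence, uniqueness, the bound, the inverse from (1.9) and the analytic extension in J).
-/

namespace Literature.MathematicalPhysics.QuantumFieldTheory.Balaban1983to89.B15Prop1Minimum

open scoped RealInnerProductSpace
open Set

variable {E F : Type*} [NormedAddCommGroup E] [InnerProductSpace ℝ E]
  [NormedAddCommGroup F] [InnerProductSpace ℝ F]

/-! ## §1 A (1.12)-critical configuration in the gauge ball minimises the function there -/

/-- `‖H x‖ ≤ hst·‖x‖` from `⟨Hx, y⟩ = ⟨x, H*y⟩` and `‖H*z‖ ≤ hst‖z‖` (the adjoint has the same norm; used to pair r13's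
two operator letters `h₁`, `hst` in the segment estimate). [cite: Balaban1989LargeFieldII, p.359 («H*_{1,k}» in (1.12))] -/
theorem norm_le_of_adjoint (H : E →ₗ[ℝ] F) (Hst : F →ₗ[ℝ] E)
    (hadj : ∀ (x : E) (y : F), ⟪H x, y⟫ = ⟪x, Hst y⟫) {hst : ℝ} (hhst : 0 ≤ hst)
    (hHst : ∀ z : F, ‖Hst z‖ ≤ hst * ‖z‖) (x : E) : ‖H x‖ ≤ hst * ‖x‖ := by
  have h : ‖H x‖ ^ 2 ≤ hst * ‖x‖ * ‖H x‖ := by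
    calc ‖H x‖ ^ 2 = ⟪H x, H x⟫ := (real_inner_self_eq_norm_sq _).symm
      _ = ⟪x, Hst (H x)⟫ := hadj _ _
      _ ≤ ‖x‖ * ‖Hst (H x)‖ := real_inner_le_norm _ _
      _ ≤ ‖x‖ * (hst * ‖H x‖) := mul_le_mul_of_nonneg_left (hHst _) (norm_nonneg _)
      _ = hst * ‖x‖ * ‖H x‖ := by ring
  by_cases h0 : ‖H x‖ = 0
  · rw [h0]; exact mul_nonneg hhst (norm_nonneg _)
  · have hp : 0 < ‖H x‖ := lt_of_le_of_ne (norm_nonneg _) (Ne.symm h0)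
    nlinarith

/-- From the first variation AT the base point (`s = 0`) in every direction at every configuration, the derivative along
the whole segment `s ↦ A(X + sδ)` at every parameter `t` (re-basing at `X + tδ`). [cite: Balaban1989LargeFieldII, p.359
(«We expand the function with respect to B′ … the condition for a critical configuration is the equation (1.12)»)] -/
theorem hasDerivAt_line {A : E → ℝ} {D : E → E → ℝ}
    (hA : ∀ X δ : E, HasDerivAt (fun s : ℝ => A (X + s • δ)) (D X δ) 0) (X δ : E) (t : ℝ) :
    HasDerivAt (fun s : ℝ => A (X + s • δ)) (D (X + t • δ) δ) t := by
  have h0 : HasDerivAt (fun s : ℝ => A ((X + t • δ) + s • δ)) (D (X + t • δ) δ) (t - t) := by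
    rw [sub_self]; exact hA _ _
  have h1 : HasDerivAt (fun s : ℝ => A ((X + t • δ) + (s - t) • δ)) (D (X + t • δ) δ) t :=
    h0.comp_sub_const t t
  have heq : (fun s : ℝ => A (X + s • δ)) = fun s : ℝ => A ((X + t • δ) + (s - t) • δ) := by
    funext s
    congr 1
    rw [sub_smul]; abel
  rw [heq]
  exact h1

/-- The algebra of the first variation along a gauge segment: at `B + tv` minus at `B` it is
`t⟨Hv, Δ₁Hv⟩ + ⟨Hv, (δ/δA)V(H(B + tv)) − (δ/δA)V(HB)⟩` (linearity of `H`, `H*`, `Δ₁` and the adjoint relation).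
[cite: Balaban1989LargeFieldII, (1.12) p.359] -/
theorem firstVariation_diff_eq (H : E →ₗ[ℝ] F) (Hst : F →ₗ[ℝ] E)
    (hadj : ∀ (x : E) (y : F), ⟪H x, y⟫ = ⟪x, Hst y⟫) (Δ₁ : F →ₗ[ℝ] F) (dV : F → F) (J : F)
    (B v : E) (t : ℝ) :
    (⟪v, Hst J⟫ + ⟪v, Hst (Δ₁ (H (B + t • v)))⟫ + ⟪v, Hst (dV (H (B + t • v)))⟫) -
        (⟪v, Hst J⟫ + ⟪v, Hst (Δ₁ (H B))⟫ + ⟪v, Hst (dV (H B))⟫) =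
      t * ⟪H v, Δ₁ (H v)⟫ + ⟪H v, dV (H (B + t • v)) - dV (H B)⟫ := by
  simp only [← hadj, map_add, map_smul, inner_add_right, inner_sub_right, real_inner_smul_right]
  ring

/-- The segment estimate: on the gauge subspace (`P₀v = v`), for `t ≥ 0` and both `H(B + tv)`, `HB` in the ball of
radius `ρ` where `(δ/δA)V` is `ℓ`-Lipschitz, the first-variation difference of `firstVariation_diff_eq` is
`≥ t·(c/2)·‖v‖²` — from the positivity (1.9) `c‖v‖² ≤ ⟨Hv, Δ₁Hv⟩`, `|⟨Hv, dV(H(B+tv)) − dV(HB)⟩| ≤ ‖Hv‖·ℓ·t‖Hv‖ ≤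
ℓ·t·hst·h₁‖v‖²` and r13's smallness `c⁻¹·hst·ℓ·h₁ ≤ ½`. [cite: Balaban1989LargeFieldII, p.359 («By the inequality (1.9)
the operator P₀H*_{1,k}Δ₁H_{1,k}P₀ is positive», «Using Proposition 4 [15]»); (1.9) p.358; Balaban1985Variational,
Prop. 4 p.293] -/
theorem firstVariation_lower_bound {P₀ : E →ₗ[ℝ] E} (H : E →ₗ[ℝ] F) (Hst : F →ₗ[ℝ] E)
    (hadj : ∀ (x : E) (y : F), ⟪H x, y⟫ = ⟪x, Hst y⟫) (Δ₁ : F →ₗ[ℝ] F) (dV : F → F) {c : ℝ}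
    (hc : 0 < c) (hpos : ∀ x, P₀ x = x → c * ‖x‖ ^ 2 ≤ ⟪H x, Δ₁ (H x)⟫) {h₁ hst ℓ ρ : ℝ}
    (hhst : 0 ≤ hst) (hℓ : 0 ≤ ℓ) (hH : ∀ x : E, ‖H x‖ ≤ h₁ * ‖x‖)
    (hHst : ∀ z : F, ‖Hst z‖ ≤ hst * ‖z‖)
    (hdV : ∀ u v : F, ‖u‖ ≤ ρ → ‖v‖ ≤ ρ → ‖dV u - dV v‖ ≤ ℓ * ‖u - v‖)
    (hsmall : c⁻¹ * hst * ℓ * h₁ ≤ 1 / 2) {B v : E} (hv : P₀ v = v) {t : ℝ} (ht : 0 ≤ t)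
    (hXρ : ‖H (B + t • v)‖ ≤ ρ) (hBρ : ‖H B‖ ≤ ρ) :
    t * (c / 2) * ‖v‖ ^ 2 ≤ t * ⟪H v, Δ₁ (H v)⟫ + ⟪H v, dV (H (B + t • v)) - dV (H B)⟫ := by
  have h1 : t * (c * ‖v‖ ^ 2) ≤ t * ⟪H v, Δ₁ (H v)⟫ := mul_le_mul_of_nonneg_left (hpos v hv) ht
  have hHv₁ : ‖H v‖ ≤ h₁ * ‖v‖ := hH v
  have hHv₂ : ‖H v‖ ≤ hst * ‖v‖ := norm_le_of_adjoint H Hst hadj hhst hHst v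
  have hdiff : H (B + t • v) - H B = t • H v := by
    rw [map_add, map_smul]; abel
  have h2 : ‖dV (H (B + t • v)) - dV (H B)‖ ≤ ℓ * (t * ‖H v‖) := by
    calc ‖dV (H (B + t • v)) - dV (H B)‖ ≤ ℓ * ‖H (B + t • v) - H B‖ := hdV _ _ hXρ hBρ
      _ = ℓ * (t * ‖H v‖) := by rw [hdiff, norm_smul, Real.norm_eq_abs, abs_of_nonneg ht]
  have h3 : |⟪H v, dV (H (B + t • v)) - dV (H B)⟫| ≤ ‖H v‖ * (ℓ * (t * ‖H v‖)) :=
    (abs_real_inner_le_norm _ _).trans (mul_le_mul_of_nonneg_left h2 (norm_nonneg _))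
  have h4 : ‖H v‖ * (ℓ * (t * ‖H v‖)) ≤ hst * ℓ * h₁ * (t * ‖v‖ ^ 2) := by
    have hsq : ‖H v‖ * ‖H v‖ ≤ (hst * ‖v‖) * (h₁ * ‖v‖) :=
      mul_le_mul hHv₂ hHv₁ (norm_nonneg _) (mul_nonneg hhst (norm_nonneg _))
    calc ‖H v‖ * (ℓ * (t * ‖H v‖)) = ℓ * t * (‖H v‖ * ‖H v‖) := by ring
      _ ≤ ℓ * t * ((hst * ‖v‖) * (h₁ * ‖v‖)) := mul_le_mul_of_nonneg_left hsq (mul_nonneg hℓ ht)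
      _ = hst * ℓ * h₁ * (t * ‖v‖ ^ 2) := by ring
  have h5 : -(hst * ℓ * h₁ * (t * ‖v‖ ^ 2)) ≤ ⟪H v, dV (H (B + t • v)) - dV (H B)⟫ := by
    have := neg_abs_le ⟪H v, dV (H (B + t • v)) - dV (H B)⟫
    linarith
  have hsm : hst * ℓ * h₁ ≤ c / 2 := by
    have hc0 : c ≠ 0 := hc.ne'
    have hmul := mul_le_mul_of_nonneg_left hsmall hc.le
    have hcc : c * (c⁻¹ * hst * ℓ * h₁) = hst * ℓ * h₁ := by field_simp
    linarith
  have h6 : hst * ℓ * h₁ * (t * ‖v‖ ^ 2) ≤ c / 2 * (t * ‖v‖ ^ 2) :=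
    mul_le_mul_of_nonneg_right hsm (mul_nonneg ht (sq_nonneg _))
  linarith

/-- **The minimum clause of Proposition 1 [IV], strict form, in the abstract model of the [LF-II] p. 359 proof.**  Let
`A : E → ℝ` have first variation `⟨δB′, H*J⟩ + ⟨δB′, H*Δ₁HB′⟩ + ⟨δB′, H*(δ/δA)V(HB′)⟩` at every `B′` in every direction
`δB′` («the condition for a critical configuration is the equation (1.12)»).  If `B` lies in the gauge subspace
(`P₀B = B`) and in the ball `‖B‖ ≤ r`, `h₁r ≤ ρ`, and is (1.12)-critical for all gauge variations, then under the
positivity (1.9) (`c‖x‖² ≤ ⟨Hx, Δ₁Hx⟩` on the gauge subspace), the `ℓ`-Lipschitz bound for `(δ/δA)V` on the ball of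
radius `ρ` (Proposition 4 [15]) and the smallness `c⁻¹·hst·ℓ·h₁ ≤ ½` of `prop1IV_model_of_pos`, every OTHER gauge-fixed
`B′` of the ball has `A B < A B′` (the function is strictly increasing along the gauge segment from `B` to `B′`).
[cite: Balaban1989LargeFieldI, Prop. 1 p.194 («An element of the orbit is a minimum of the function»);
Balaban1989LargeFieldII, p.359 (proof of Proposition 1 [IV]), (1.9) p.358; Balaban1985Variational, Prop. 4 p.293] -/
theorem lt_of_critical_of_ne {P₀ : E →ₗ[ℝ] E} (H : E →ₗ[ℝ] F) (Hst : F →ₗ[ℝ] E)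
    (hadj : ∀ (x : E) (y : F), ⟪H x, y⟫ = ⟪x, Hst y⟫) (Δ₁ : F →ₗ[ℝ] F) (dV : F → F) (J : F)
    {A : E → ℝ}
    (hA : ∀ X δ : E, HasDerivAt (fun s : ℝ => A (X + s • δ))
      (⟪δ, Hst J⟫ + ⟪δ, Hst (Δ₁ (H X))⟫ + ⟪δ, Hst (dV (H X))⟫) 0)
    {c : ℝ} (hc : 0 < c) (hpos : ∀ x, P₀ x = x → c * ‖x‖ ^ 2 ≤ ⟪H x, Δ₁ (H x)⟫)
    {h₁ hst ℓ ρ r : ℝ} (hh₁ : 0 ≤ h₁) (hhst : 0 ≤ hst) (hℓ : 0 ≤ ℓ)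
    (hH : ∀ x : E, ‖H x‖ ≤ h₁ * ‖x‖) (hHst : ∀ z : F, ‖Hst z‖ ≤ hst * ‖z‖)
    (hdV : ∀ u v : F, ‖u‖ ≤ ρ → ‖v‖ ≤ ρ → ‖dV u - dV v‖ ≤ ℓ * ‖u - v‖) (hρ : h₁ * r ≤ ρ)
    (hsmall : c⁻¹ * hst * ℓ * h₁ ≤ 1 / 2) {B : E} (hBg : P₀ B = B) (hBn : ‖B‖ ≤ r)
    (hcrit : ∀ δB : E, P₀ δB = δB →
      ⟪δB, Hst J⟫ + ⟪δB, Hst (Δ₁ (H B))⟫ + ⟪δB, Hst (dV (H B))⟫ = 0)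
    {B' : E} (hB'g : P₀ B' = B') (hB'n : ‖B'‖ ≤ r) (hne : B' ≠ B) : A B < A B' := by
  set v : E := B' - B with hv
  have hvg : P₀ v = v := by rw [hv, map_sub, hBg, hB'g]
  have hvn : 0 < ‖v‖ := norm_pos_iff.mpr (sub_ne_zero.mpr hne)
  set φ : ℝ → ℝ := fun s => A (B + s • v) with hφ
  -- the derivative of φ at every parameter
  have hder : ∀ t : ℝ, HasDerivAt φ
      (⟪v, Hst J⟫ + ⟪v, Hst (Δ₁ (H (B + t • v)))⟫ + ⟪v, Hst (dV (H (B + t • v)))⟫) t :=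
    fun t => hasDerivAt_line
      (D := fun X δ => ⟪δ, Hst J⟫ + ⟪δ, Hst (Δ₁ (H X))⟫ + ⟪δ, Hst (dV (H X))⟫) hA B v t
  have hcont : ContinuousOn φ (Icc 0 1) := fun t _ => (hder t).continuousAt.continuousWithinAt
  -- the segment stays in the ball of radius r, its H-image in the ball of radius ρ
  have hseg : ∀ t : ℝ, 0 ≤ t → t ≤ 1 → ‖B + t • v‖ ≤ r := by
    intro t ht0 ht1
    have hrepr : B + t • v = (1 - t) • B + t • B' := by
      rw [hv, smul_sub, sub_smul, one_smul]; abel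
    rw [hrepr]
    calc ‖(1 - t) • B + t • B'‖ ≤ ‖(1 - t) • B‖ + ‖t • B'‖ := norm_add_le _ _
      _ = (1 - t) * ‖B‖ + t * ‖B'‖ := by
          rw [norm_smul, norm_smul, Real.norm_eq_abs, Real.norm_eq_abs, abs_of_nonneg (by linarith),
            abs_of_nonneg ht0]
      _ ≤ (1 - t) * r + t * r :=
          add_le_add (mul_le_mul_of_nonneg_left hBn (by linarith)) (mul_le_mul_of_nonneg_left hB'n ht0)
      _ = r := by ring
  have hHρ : ∀ X : E, ‖X‖ ≤ r → ‖H X‖ ≤ ρ := fun X hX =>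
    (hH X).trans ((mul_le_mul_of_nonneg_left hX hh₁).trans hρ)
  -- the derivative is positive inside the segment
  have hpos' : ∀ t ∈ interior (Icc (0 : ℝ) 1), 0 < deriv φ t := by
    intro t ht
    rw [interior_Icc] at ht
    obtain ⟨ht0, ht1⟩ := ht
    rw [(hder t).deriv]
    have hdiff := firstVariation_diff_eq H Hst hadj Δ₁ dV J B v t
    rw [hcrit v hvg, sub_zero] at hdiff
    rw [hdiff]
    have hlow := firstVariation_lower_bound H Hst hadj Δ₁ dV hc hpos hhst hℓ hH hHst hdV hsmall hvg ht0.le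
      (hHρ _ (hseg t ht0.le ht1.le)) (hHρ _ hBn)
    have hmargin : 0 < t * (c / 2) * ‖v‖ ^ 2 := mul_pos (mul_pos ht0 (half_pos hc)) (pow_pos hvn 2)
    linarith
  have hmono : StrictMonoOn φ (Icc 0 1) := strictMonoOn_of_deriv_pos (convex_Icc 0 1) hcont hpos'
  have h01 : φ 0 < φ 1 :=
    hmono (left_mem_Icc.mpr zero_le_one) (right_mem_Icc.mpr zero_le_one) zero_lt_one
  have hφ0 : φ 0 = A B := by simp [hφ]
  have hφ1 : φ 1 = A B' := by
    simp only [hφ, one_smul, hv]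
    congr 1; abel
  rwa [hφ0, hφ1] at h01

/-- **The minimum clause of Proposition 1 [IV] in the abstract model** (non-strict form of `lt_of_critical_of_ne`): the
(1.12)-critical gauge-fixed configuration `B` of the ball `‖B′‖ ≤ r` (`h₁r ≤ ρ`) satisfies `A B ≤ A B′` for every
gauge-fixed `B′` of that ball. [cite: Balaban1989LargeFieldI, Prop. 1 p.194 («An element of the orbit is a minimum of
the function»); Balaban1989LargeFieldII, p.359 (proof of Proposition 1 [IV])] -/
theorem le_of_critical {P₀ : E →ₗ[ℝ] E} (H : E →ₗ[ℝ] F) (Hst : F →ₗ[ℝ] E)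
    (hadj : ∀ (x : E) (y : F), ⟪H x, y⟫ = ⟪x, Hst y⟫) (Δ₁ : F →ₗ[ℝ] F) (dV : F → F) (J : F)
    {A : E → ℝ}
    (hA : ∀ X δ : E, HasDerivAt (fun s : ℝ => A (X + s • δ))
      (⟪δ, Hst J⟫ + ⟪δ, Hst (Δ₁ (H X))⟫ + ⟪δ, Hst (dV (H X))⟫) 0)
    {c : ℝ} (hc : 0 < c) (hpos : ∀ x, P₀ x = x → c * ‖x‖ ^ 2 ≤ ⟪H x, Δ₁ (H x)⟫)
    {h₁ hst ℓ ρ r : ℝ} (hh₁ : 0 ≤ h₁) (hhst : 0 ≤ hst) (hℓ : 0 ≤ ℓ)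
    (hH : ∀ x : E, ‖H x‖ ≤ h₁ * ‖x‖) (hHst : ∀ z : F, ‖Hst z‖ ≤ hst * ‖z‖)
    (hdV : ∀ u v : F, ‖u‖ ≤ ρ → ‖v‖ ≤ ρ → ‖dV u - dV v‖ ≤ ℓ * ‖u - v‖) (hρ : h₁ * r ≤ ρ)
    (hsmall : c⁻¹ * hst * ℓ * h₁ ≤ 1 / 2) {B : E} (hBg : P₀ B = B) (hBn : ‖B‖ ≤ r)
    (hcrit : ∀ δB : E, P₀ δB = δB →
      ⟪δB, Hst J⟫ + ⟪δB, Hst (Δ₁ (H B))⟫ + ⟪δB, Hst (dV (H B))⟫ = 0)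
    {B' : E} (hB'g : P₀ B' = B') (hB'n : ‖B'‖ ≤ r) : A B ≤ A B' := by
  by_cases hne : B' = B
  · rw [hne]
  · exact (lt_of_critical_of_ne H Hst hadj Δ₁ dV J hA hc hpos hh₁ hhst hℓ hH hHst hdV hρ hsmall hBg hBn hcrit
      hB'g hB'n hne).le

/-- `IsMinOn` packaging of `le_of_critical`: the critical configuration minimises `A` on the gauge-fixed part of the ball,
`{B′ | P₀B′ = B′ ∧ ‖B′‖ ≤ r}`. [cite: Balaban1989LargeFieldI, Prop. 1 p.194; Balaban1989LargeFieldII, p.359] -/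
theorem isMinOn_gaugeBall_of_critical {P₀ : E →ₗ[ℝ] E} (H : E →ₗ[ℝ] F) (Hst : F →ₗ[ℝ] E)
    (hadj : ∀ (x : E) (y : F), ⟪H x, y⟫ = ⟪x, Hst y⟫) (Δ₁ : F →ₗ[ℝ] F) (dV : F → F) (J : F)
    {A : E → ℝ}
    (hA : ∀ X δ : E, HasDerivAt (fun s : ℝ => A (X + s • δ))
      (⟪δ, Hst J⟫ + ⟪δ, Hst (Δ₁ (H X))⟫ + ⟪δ, Hst (dV (H X))⟫) 0)
    {c : ℝ} (hc : 0 < c) (hpos : ∀ x, P₀ x = x → c * ‖x‖ ^ 2 ≤ ⟪H x, Δ₁ (H x)⟫)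
    {h₁ hst ℓ ρ r : ℝ} (hh₁ : 0 ≤ h₁) (hhst : 0 ≤ hst) (hℓ : 0 ≤ ℓ)
    (hH : ∀ x : E, ‖H x‖ ≤ h₁ * ‖x‖) (hHst : ∀ z : F, ‖Hst z‖ ≤ hst * ‖z‖)
    (hdV : ∀ u v : F, ‖u‖ ≤ ρ → ‖v‖ ≤ ρ → ‖dV u - dV v‖ ≤ ℓ * ‖u - v‖) (hρ : h₁ * r ≤ ρ)
    (hsmall : c⁻¹ * hst * ℓ * h₁ ≤ 1 / 2) {B : E} (hBg : P₀ B = B) (hBn : ‖B‖ ≤ r)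
    (hcrit : ∀ δB : E, P₀ δB = δB →
      ⟪δB, Hst J⟫ + ⟪δB, Hst (Δ₁ (H B))⟫ + ⟪δB, Hst (dV (H B))⟫ = 0) :
    IsMinOn A {B' : E | P₀ B' = B' ∧ ‖B'‖ ≤ r} B := fun _ hB' =>
  le_of_critical H Hst hadj Δ₁ dV J hA hc hpos hh₁ hhst hℓ hH hHst hdV hρ hsmall hBg hBn hcrit hB'.1 hB'.2

/-- THE minimum: any gauge-fixed `B″` of the ball with `A B″ ≤ A B` IS `B` (uniqueness of the minimiser on the gauge ball,
matching «exactly one critical orbit … An element of the orbit is a minimum»). [cite: Balaban1989LargeFieldI, Prop. 1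
p.194; Balaban1989LargeFieldII, p.359] -/
theorem eq_of_le_of_critical {P₀ : E →ₗ[ℝ] E} (H : E →ₗ[ℝ] F) (Hst : F →ₗ[ℝ] E)
    (hadj : ∀ (x : E) (y : F), ⟪H x, y⟫ = ⟪x, Hst y⟫) (Δ₁ : F →ₗ[ℝ] F) (dV : F → F) (J : F)
    {A : E → ℝ}
    (hA : ∀ X δ : E, HasDerivAt (fun s : ℝ => A (X + s • δ))
      (⟪δ, Hst J⟫ + ⟪δ, Hst (Δ₁ (H X))⟫ + ⟪δ, Hst (dV (H X))⟫) 0)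
    {c : ℝ} (hc : 0 < c) (hpos : ∀ x, P₀ x = x → c * ‖x‖ ^ 2 ≤ ⟪H x, Δ₁ (H x)⟫)
    {h₁ hst ℓ ρ r : ℝ} (hh₁ : 0 ≤ h₁) (hhst : 0 ≤ hst) (hℓ : 0 ≤ ℓ)
    (hH : ∀ x : E, ‖H x‖ ≤ h₁ * ‖x‖) (hHst : ∀ z : F, ‖Hst z‖ ≤ hst * ‖z‖)
    (hdV : ∀ u v : F, ‖u‖ ≤ ρ → ‖v‖ ≤ ρ → ‖dV u - dV v‖ ≤ ℓ * ‖u - v‖) (hρ : h₁ * r ≤ ρ)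
    (hsmall : c⁻¹ * hst * ℓ * h₁ ≤ 1 / 2) {B : E} (hBg : P₀ B = B) (hBn : ‖B‖ ≤ r)
    (hcrit : ∀ δB : E, P₀ δB = δB →
      ⟪δB, Hst J⟫ + ⟪δB, Hst (Δ₁ (H B))⟫ + ⟪δB, Hst (dV (H B))⟫ = 0)
    {B'' : E} (hB''g : P₀ B'' = B'') (hB''n : ‖B''‖ ≤ r) (hle : A B'' ≤ A B) : B'' = B := by
  by_contra hne
  exact absurd hle (not_le.mpr (lt_of_critical_of_ne H Hst hadj Δ₁ dV J hA hc hpos hh₁ hhst hℓ hH hHst hdV hρ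
    hsmall hBg hBn hcrit hB''g hB''n hne))

/-! ## §2 The printed expansion has the first variation (1.12) -/

/-- One-variable calculus: `s ↦ α + βs + γs²` has derivative `β` at `s = 0` (the polynomial part of the expansion along a
segment; private plumbing). [folklore] -/
private theorem hasDerivAt_quadratic (α β γ : ℝ) : HasDerivAt (fun s : ℝ => α + β * s + γ * s ^ 2) β 0 := by
  have h1 : HasDerivAt (fun s : ℝ => α + β * s) β 0 := by
    simpa using ((hasDerivAt_id' (0 : ℝ)).const_mul β).const_add α
  have h2 : HasDerivAt (fun s : ℝ => γ * s ^ 2) 0 0 := by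
    simpa using (hasDerivAt_pow 2 (0 : ℝ)).const_mul γ
  simpa [Pi.add_def] using h1.add h2

/-- **«We expand the function with respect to B′»** (p. 359): the expansion
`B′ ↦ a₀ + ⟨HB′, J⟩ + ½⟨HB′, Δ₁HB′⟩ + V(HB′)` — constant + current term + quadratic form + higher order (the shape of [15]
(81) transported by `H = H_{1,k}`) — with `Δ₁` symmetric and `dV = (δ/δA)V` the Gateaux gradient of `V`, has first
variation at `B′` in the direction `δB′` equal to `⟨δB′, H*J⟩ + ⟨δB′, H*Δ₁HB′⟩ + ⟨δB′, H*(δ/δA)V(HB′)⟩`, the left side of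
(1.12): the hypothesis `hA` of §1 is inhabited by the printed function. [cite: Balaban1989LargeFieldII, p.359 («We expand
the function with respect to B′, the expansion has the same form as in the exponentials in (5.2) … Now the condition for
a critical configuration is the equation (1.12)»); Balaban1985Variational, (81) p.290] -/
theorem hasDerivAt_expansion (H : E →ₗ[ℝ] F) (Hst : F →ₗ[ℝ] E)
    (hadj : ∀ (x : E) (y : F), ⟪H x, y⟫ = ⟪x, Hst y⟫) (Δ₁ : F →ₗ[ℝ] F)
    (hΔ : ∀ u w : F, ⟪Δ₁ u, w⟫ = ⟪u, Δ₁ w⟫) {V : F → ℝ} {dV : F → F}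
    (hV : ∀ u w : F, HasDerivAt (fun s : ℝ => V (u + s • w)) ⟪w, dV u⟫ 0) (a₀ : ℝ) (J : F) (X δ : E) :
    HasDerivAt (fun s : ℝ => a₀ + ⟪H (X + s • δ), J⟫ + 1 / 2 * ⟪H (X + s • δ), Δ₁ (H (X + s • δ))⟫
        + V (H (X + s • δ))) (⟪δ, Hst J⟫ + ⟪δ, Hst (Δ₁ (H X))⟫ + ⟪δ, Hst (dV (H X))⟫) 0 := by
  -- the polynomial part (constant, linear, quadratic in s) and its derivative at 0
  have hpoly : HasDerivAt (fun s : ℝ => (a₀ + ⟪H X, J⟫ + 1 / 2 * ⟪H X, Δ₁ (H X)⟫)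
      + (⟪H δ, J⟫ + ⟪H δ, Δ₁ (H X)⟫) * s + (1 / 2 * ⟪H δ, Δ₁ (H δ)⟫) * s ^ 2)
      (⟪H δ, J⟫ + ⟪H δ, Δ₁ (H X)⟫) 0 :=
    hasDerivAt_quadratic _ _ _
  -- the higher-order part along the transported segment
  have hVp : HasDerivAt (fun s : ℝ => V (H X + s • H δ)) ⟪H δ, dV (H X)⟫ 0 := hV (H X) (H δ)
  have hsum : HasDerivAt (fun s : ℝ => ((a₀ + ⟪H X, J⟫ + 1 / 2 * ⟪H X, Δ₁ (H X)⟫)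
      + (⟪H δ, J⟫ + ⟪H δ, Δ₁ (H X)⟫) * s + (1 / 2 * ⟪H δ, Δ₁ (H δ)⟫) * s ^ 2) + V (H X + s • H δ))
      ((⟪H δ, J⟫ + ⟪H δ, Δ₁ (H X)⟫) + ⟪H δ, dV (H X)⟫) 0 := hpoly.add hVp
  have hcomm : ⟪H X, Δ₁ (H δ)⟫ = ⟪H δ, Δ₁ (H X)⟫ :=
    (real_inner_comm (Δ₁ (H δ)) (H X)).trans (hΔ (H δ) (H X))
  -- the printed function IS that sum, and the printed first variation IS that derivative
  have hfun : (fun s : ℝ => a₀ + ⟪H (X + s • δ), J⟫ + 1 / 2 * ⟪H (X + s • δ), Δ₁ (H (X + s • δ))⟫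
      + V (H (X + s • δ))) = fun s : ℝ => ((a₀ + ⟪H X, J⟫ + 1 / 2 * ⟪H X, Δ₁ (H X)⟫)
      + (⟪H δ, J⟫ + ⟪H δ, Δ₁ (H X)⟫) * s + (1 / 2 * ⟪H δ, Δ₁ (H δ)⟫) * s ^ 2) + V (H X + s • H δ) := by
    funext s
    simp only [map_add, map_smul, inner_add_left, inner_add_right, real_inner_smul_left,
      real_inner_smul_right, hcomm]
    ring
  have hval : ⟪δ, Hst J⟫ + ⟪δ, Hst (Δ₁ (H X))⟫ + ⟪δ, Hst (dV (H X))⟫ =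
      (⟪H δ, J⟫ + ⟪H δ, Δ₁ (H X)⟫) + ⟪H δ, dV (H X)⟫ := by
    simp only [← hadj]
  rw [hfun, hval]
  exact hsum

/-! ## §3 Capstone: Proposition 1 [IV] in the model (r13) ∧ the minimum clause -/

/-- **Proposition 1 [IV] (p. 359 model) with the minimum clause** = r13's `B16Prop1IVAssembly.prop1IV_model_of_pos` BY
NAME (finite-dimensional `E`; the inverse `K⁻¹` of `P₀H*Δ₁HP₀` from the positivity (1.9); exactly one (1.12)-critical
gauge-fixed `B′` in the ball of radius `2‖K⁻¹P₀H*J‖ ≤ 2c⁻¹hst‖J‖`, *«twice a bound of the right-hand side»*) ∧, for any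
function `A : E → ℝ` with the first variation (1.12) (`hA`), *«An element of the orbit is a minimum of the function»*: that
`B′` minimises `A` over the gauge-fixed configurations of the existence ball, STRICTLY (so it is the only minimiser
there), and the same on every larger ball of radius `r` with `h₁r ≤ ρ` (the whole Proposition-4 chart).  No hypothesis
beyond r13's except `A`/`hA`. [cite: Balaban1989LargeFieldI, Prop. 1 (1.78) p.194; Balaban1989LargeFieldII, p.359 (proof
of Proposition 1 [IV]), (1.9) p.358; Balaban1985Variational, Prop. 4 p.293] -/
theorem prop1IV_model_of_pos_minimum [FiniteDimensional ℝ E] {P₀ : E →ₗ[ℝ] E}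
    (hP2 : ∀ x, P₀ (P₀ x) = P₀ x) (hPsa : ∀ x y, ⟪P₀ x, y⟫ = ⟪x, P₀ y⟫) (H : E →ₗ[ℝ] F) (Hst : F →ₗ[ℝ] E)
    (hadj : ∀ (x : E) (y : F), ⟪H x, y⟫ = ⟪x, Hst y⟫) (Δ₁ : F →ₗ[ℝ] F) (dV : F → F) (J : F) {c : ℝ}
    (hc : 0 < c) (hpos : ∀ x, P₀ x = x → c * ‖x‖ ^ 2 ≤ ⟪H x, Δ₁ (H x)⟫) (hdV0 : dV 0 = 0)
    {h₁ hst ℓ ρ : ℝ} (hh₁ : 0 ≤ h₁) (hhst : 0 ≤ hst) (hℓ : 0 ≤ ℓ) (hH : ∀ x : E, ‖H x‖ ≤ h₁ * ‖x‖)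
    (hHst : ∀ z : F, ‖Hst z‖ ≤ hst * ‖z‖)
    (hdV : ∀ u v : F, ‖u‖ ≤ ρ → ‖v‖ ≤ ρ → ‖dV u - dV v‖ ≤ ℓ * ‖u - v‖)
    (hρ : h₁ * (2 * (c⁻¹ * hst * ‖J‖)) ≤ ρ) (hsmall : c⁻¹ * hst * ℓ * h₁ ≤ 1 / 2) {A : E → ℝ}
    (hA : ∀ X δ : E, HasDerivAt (fun s : ℝ => A (X + s • δ))
      (⟪δ, Hst J⟫ + ⟪δ, Hst (Δ₁ (H X))⟫ + ⟪δ, Hst (dV (H X))⟫) 0) :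
    ∃ Kinv : E →ₗ[ℝ] E, ((∀ x, Kinv (P₀ (Hst (Δ₁ (H (P₀ x))))) = P₀ x) ∧
        (∀ x, P₀ (Hst (Δ₁ (H (P₀ (Kinv x))))) = P₀ x) ∧ (∀ x, Kinv (P₀ x) = Kinv x) ∧
        (∀ x, P₀ (Kinv x) = Kinv x) ∧ ∀ x, ‖Kinv x‖ ≤ c⁻¹ * ‖P₀ x‖) ∧
      2 * ‖Kinv (P₀ (Hst J))‖ ≤ 2 * (c⁻¹ * hst * ‖J‖) ∧
      ∃ B : E, (P₀ B = B ∧ ‖B‖ ≤ 2 * ‖Kinv (P₀ (Hst J))‖ ∧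
          ∀ δB : E, P₀ δB = δB → ⟪δB, Hst J⟫ + ⟪δB, Hst (Δ₁ (H B))⟫ + ⟪δB, Hst (dV (H B))⟫ = 0) ∧
        (∀ B' : E, P₀ B' = B' → ‖B'‖ ≤ 2 * ‖Kinv (P₀ (Hst J))‖ →
          (∀ δB : E, P₀ δB = δB →
            ⟪δB, Hst J⟫ + ⟪δB, Hst (Δ₁ (H B'))⟫ + ⟪δB, Hst (dV (H B'))⟫ = 0) → B' = B) ∧
        (∀ B' : E, P₀ B' = B' → ‖B'‖ ≤ 2 * ‖Kinv (P₀ (Hst J))‖ → A B ≤ A B') ∧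
        (∀ B' : E, P₀ B' = B' → ‖B'‖ ≤ 2 * ‖Kinv (P₀ (Hst J))‖ → B' ≠ B → A B < A B') ∧
        (∀ r : ℝ, 2 * ‖Kinv (P₀ (Hst J))‖ ≤ r → h₁ * r ≤ ρ →
          ∀ B' : E, P₀ B' = B' → ‖B'‖ ≤ r → A B ≤ A B' ∧ (B' ≠ B → A B < A B')) := by
  obtain ⟨Kinv, hK, hJ, B, ⟨hBg, hBn, hcrit⟩, huniq⟩ :=
    B16Prop1IVAssembly.prop1IV_model_of_pos hP2 hPsa H Hst hadj Δ₁ dV J hc hpos hdV0 hh₁ hhst hℓ hH hHst hdV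
      hρ hsmall
  have hρ' : h₁ * (2 * ‖Kinv (P₀ (Hst J))‖) ≤ ρ := (mul_le_mul_of_nonneg_left hJ hh₁).trans hρ
  refine ⟨Kinv, hK, hJ, B, ⟨hBg, hBn, hcrit⟩, huniq, ?_, ?_, ?_⟩
  · intro B' hB'g hB'n
    exact le_of_critical H Hst hadj Δ₁ dV J hA hc hpos hh₁ hhst hℓ hH hHst hdV hρ' hsmall hBg hBn hcrit hB'g hB'n
  · intro B' hB'g hB'n hne
    exact lt_of_critical_of_ne H Hst hadj Δ₁ dV J hA hc hpos hh₁ hhst hℓ hH hHst hdV hρ' hsmall hBg hBn hcrit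
      hB'g hB'n hne
  · intro r hr hρr B' hB'g hB'n
    exact ⟨le_of_critical H Hst hadj Δ₁ dV J hA hc hpos hh₁ hhst hℓ hH hHst hdV hρr hsmall hBg (hBn.trans hr)
        hcrit hB'g hB'n,
      fun hne => lt_of_critical_of_ne H Hst hadj Δ₁ dV J hA hc hpos hh₁ hhst hℓ hH hHst hdV hρr hsmall hBg
        (hBn.trans hr) hcrit hB'g hB'n hne⟩

end Literature.MathematicalPhysics.QuantumFieldTheory.Balaban1983to89.B15Prop1Minimum
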